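import Literature.Computability.Complexity.GateEliminationAffine

/-!
# Gate elimination, VII: the xor-part as an affine self-map; no self-loops at gates fed by constants

Continues `GateEliminationAffine.lean` (Li–Yang, STOC 2022, §2.5; full version ECCC TR21-023,
pp. 10–11: "the cyclic xor-circuit `C` is said to be fair if `A` is of full rank"). Still no
matrices: the linear system of the xor-part on input `x` is packaged as the **affine self-map**
`xorMap x : (xorPart → Bool) → (xorPart → Bool)`, `u ↦ u ⊕ (right-hand sides)`, whose zeros are
the solutions of the xor-part equations (`xorMap_eq_false_iff`). Everything is PROVED.

* `xorMap_xor3` — the self-map is affine.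
* `Fair.xorMap_injective`, `Fair.xorMap_surjective` — under fairness it is a bijection ("full
  rank"): a collision plus the actual solution would give a second solution.
* `fair_of_xorPart` — conversely, unique solvability of the xor-part alone implies fairness (the
  acyclic part evaluates), so the vendored `Semicircuit.Fair` agrees with the printed notion.
* **No self-loops at gates fed by a constant or a variable** in a fair semicircuit:
  `Fair.not_reads_self_of_const` (the equation `G = G ⊕ b ⊕ c` would make the coordinate `G` of
  the self-map constant, contradicting surjectivity; in the acyclic part by acyclicity) and
  `Fair.not_reads_self_of_var` (`G = G ⊕ x_i ⊕ c` forces `x_i = c`). These discharge the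
  hypothesis `hself` of the packaged Rules 2/3 (`GateEliminationRules23.lean`). (Self-loops with
  a *gate* as the other input do occur in fair semicircuits, e.g. `G₁ = G₁ ⊕ G₂ ⊕ c₁`,
  `G₂ = G₂ ⊕ G₁ ⊕ c₂`.)

## References

* J. Li, T. Yang, *3.1n − o(n) circuit lower bounds for explicit functions*, STOC 2022
  [LiYang2022]; full version ECCC TR21-023, Def. 2.5, §2.5.
-/

namespace Literature.Computability.Complexity

open Finset

namespace Semicircuit

variable {n : ℕ} (C : Semicircuit n)

/-! ### Vectors on the xor-part -/

/-- Values on the gates of the xor-part. [cite: LiYang2022, §2.5] -/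
abbrev KVec : Type := C.xorPart → Bool

/-- Extending values on the xor-part by `false` elsewhere. [folklore] -/
def extendK (u : C.KVec) : Fin C.m → Bool := fun j => if h : j ∈ C.xorPart then u ⟨j, h⟩ else false

/-- Restricting values to the xor-part. [folklore] -/
def restrictK (w : Fin C.m → Bool) : C.KVec := fun k => w k

/-- `extendK` at a gate of the xor-part. [folklore] -/
@[simp] theorem extendK_apply_mem (u : C.KVec) {j : Fin C.m} (h : j ∈ C.xorPart) :
    C.extendK u j = u ⟨j, h⟩ := by
  simp [extendK, h]

/-- `restrictK ∘ extendK = id`. [folklore] -/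
@[simp] theorem restrictK_extendK (u : C.KVec) : C.restrictK (C.extendK u) = u := by
  funext ⟨j, h⟩; simp [restrictK, extendK, h]

/-- **The xor-part self-map** on input `x`: `F(u)_k = u_k ⊕ op_k(inputs)` — the residual of the
gate equation of `k`; the solutions of the xor-part equations are the zeros of `F`
(Li–Yang §2.5: the linear system `A g = b` of the cyclic xor-circuit). [cite: LiYang2022, §2.5] -/
def xorMap (x : Fin n → Bool) (u : C.KVec) : C.KVec :=
  fun k => u k ^^ C.op k (C.nodeVal x (C.extendK u) (C.arg k 0)) (C.nodeVal x (C.extendK u) (C.arg k 1))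

/-- Zeros of the xor-part self-map are the solutions of the xor-part equations. [cite: LiYang2022, §2.5] -/
theorem xorMap_eq_false_iff (x : Fin n → Bool) (u : C.KVec) :
    (∀ k, C.xorMap x u k = false) ↔ C.XorConsistent x (C.extendK u) := by
  constructor
  · intro h j hj
    have := h ⟨j, hj⟩
    unfold xorMap at this
    unfold GateEq
    rw [C.extendK_apply_mem u hj]
    revert this
    generalize u ⟨j, hj⟩ = a
    generalize C.op j _ _ = b
    cases a <;> cases b <;> simp
  · intro h ⟨j, hj⟩
    have := h j hj
    unfold GateEq at this
    unfold xorMap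
    rw [C.extendK_apply_mem u hj] at this
    rw [← this]
    simp

/-- The xor-part equations of `w` only see `restrictK w`. [folklore] -/
theorem xorConsistent_extendK_restrictK_iff (x : Fin n → Bool) (w : Fin C.m → Bool) :
    C.XorConsistent x (C.extendK (C.restrictK w)) ↔ C.XorConsistent x w := by
  have hK : ∀ j ∈ C.xorPart, C.extendK (C.restrictK w) j = w j := fun j hj => by
    rw [C.extendK_apply_mem _ hj]; rfl
  exact ⟨fun h => h.congr fun j hj => (hK j hj).symm, fun h => h.congr hK⟩

/-- Node values under `extendK` of a xor of three vectors. [folklore] -/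
theorem nodeVal_extendK_xor3 (x : Fin n → Bool) (u₁ u₂ u₃ : C.KVec) (v : Node n C.m) :
    C.nodeVal x (C.extendK (xor3 u₁ u₂ u₃)) v =
      ((C.nodeVal x (C.extendK u₁) v ^^ C.nodeVal x (C.extendK u₂) v) ^^ C.nodeVal x (C.extendK u₃) v) := by
  cases v with
  | const b => cases b <;> rfl
  | var i => show x i = ((x i ^^ x i) ^^ x i); cases x i <;> rfl
  | gate k =>
    show C.extendK _ k = ((C.extendK u₁ k ^^ C.extendK u₂ k) ^^ C.extendK u₃ k)
    simp only [extendK, xor3]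
    split_ifs <;> rfl

/-- **The xor-part self-map is affine**: `F(u₁ ⊕ u₂ ⊕ u₃) = F u₁ ⊕ F u₂ ⊕ F u₃`. [cite: LiYang2022, §2.5] -/
theorem xorMap_xor3 (x : Fin n → Bool) (u₁ u₂ u₃ : C.KVec) :
    C.xorMap x (xor3 u₁ u₂ u₃) = xor3 (C.xorMap x u₁) (C.xorMap x u₂) (C.xorMap x u₃) := by
  funext ⟨j, hj⟩
  obtain ⟨c, hc⟩ := C.isXorOp_of_mem j hj
  show C.xorMap x (xor3 u₁ u₂ u₃) ⟨j, hj⟩ =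
    ((C.xorMap x u₁ ⟨j, hj⟩ ^^ C.xorMap x u₂ ⟨j, hj⟩) ^^ C.xorMap x u₃ ⟨j, hj⟩)
  simp only [xorMap]
  rw [nodeVal_extendK_xor3, nodeVal_extendK_xor3, hc, hc, hc, hc]
  simp only [xor3]
  generalize u₁ ⟨j, hj⟩ = p₁; generalize u₂ ⟨j, hj⟩ = p₂; generalize u₃ ⟨j, hj⟩ = p₃
  generalize C.nodeVal x (C.extendK u₁) (C.arg j 0) = a₁
  generalize C.nodeVal x (C.extendK u₂) (C.arg j 0) = a₂
  generalize C.nodeVal x (C.extendK u₃) (C.arg j 0) = a₃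
  generalize C.nodeVal x (C.extendK u₁) (C.arg j 1) = b₁
  generalize C.nodeVal x (C.extendK u₂) (C.arg j 1) = b₂
  generalize C.nodeVal x (C.extendK u₃) (C.arg j 1) = b₃
  cases p₁ <;> cases p₂ <;> cases p₃ <;> cases a₁ <;> cases a₂ <;> cases a₃ <;> cases b₁ <;> cases b₂ <;>
    cases b₃ <;> cases c <;> rfl

variable {C} in
/-- **Under fairness the xor-part self-map is injective** (so the linear system has full rank):
two vectors with the same image differ by a vector in the kernel, which added to the actual
solution would give a second solution. [cite: LiYang2022, §2.5] -/
theorem Fair.xorMap_injective (hF : C.Fair) (x : Fin n → Bool) : Function.Injective (C.xorMap x) := by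
  intro u u' huu
  by_contra hne
  -- the actual solution, restricted to the xor-part
  set u₀ := C.restrictK (C.sol hF x) with hu₀
  have h0 : ∀ k, C.xorMap x u₀ k = false :=
    (C.xorMap_eq_false_iff x u₀).mpr ((C.xorConsistent_extendK_restrictK_iff x _).mpr
      (consistent_iff_xor_acyclic.mp (C.consistent_sol hF x)).1)
  -- `u₀ ⊕ u ⊕ u'` is another zero
  have h1 : ∀ k, C.xorMap x (xor3 u₀ u u') k = false := by
    intro k
    rw [xorMap_xor3]
    unfold xor3
    rw [h0 k, huu]
    simp
  have hsol := (C.xorMap_eq_false_iff x _).mp h1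
  have hsol₀ := (C.xorMap_eq_false_iff x _).mp h0
  have heq := hF.xor_unique hsol hsol₀
  apply hne
  funext ⟨j, hj⟩
  have := heq j hj
  rw [C.extendK_apply_mem _ hj, C.extendK_apply_mem _ hj] at this
  unfold xor3 at this
  revert this
  generalize u₀ ⟨j, hj⟩ = a
  generalize u ⟨j, hj⟩ = b
  generalize u' ⟨j, hj⟩ = b'
  cases a <;> cases b <;> cases b' <;> simp

variable {C} in
/-- Hence the self-map is surjective: **no coordinate of `F` is constant** — no equation of the
xor-part is vacuous or contradictory. [cite: LiYang2022, §2.5] -/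
theorem Fair.xorMap_surjective (hF : C.Fair) (x : Fin n → Bool) : Function.Surjective (C.xorMap x) :=
  Finite.injective_iff_surjective.mp (hF.xorMap_injective x)

variable {C} in
/-- **Fairness is a property of the xor-part** (Li–Yang §2.5: "a semicircuit is fair if the
cyclic xor-circuit is fair"): if for every input the xor-part equations have exactly one solution
on the xor-part, the semicircuit is fair (the acyclic part then evaluates uniquely); with
`Fair.xor_unique` this shows that the vendored `Fair` agrees with the printed definition.
[cite: LiYang2022, §2.5] -/
theorem fair_of_xorPart (hex : ∀ x : Fin n → Bool, ∃ w, C.XorConsistent x w)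
    (huniq : ∀ (x : Fin n → Bool) (w w' : Fin C.m → Bool), C.XorConsistent x w → C.XorConsistent x w' →
      ∀ j ∈ C.xorPart, w j = w' j) : C.Fair := by
  intro x
  obtain ⟨w, hw⟩ := hex x
  obtain ⟨W, hW, -⟩ := hw.exists_consistent
  refine ⟨W, hW, fun W' hW' => ?_⟩
  have h1 := consistent_iff_xor_acyclic.mp hW
  have h2 := consistent_iff_xor_acyclic.mp hW'
  exact C.acyclicConsistent_unique x h2.2 h1.2 (huniq x W' W h2.1 h1.1)

/-! ### No self-loops at gates fed by a constant or a variable -/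

variable {C} in
/-- In the acyclic part no gate reads itself. [cite: LiYang2022, Def. 2.5] -/
theorem arg_ne_self_of_not_mem {k₀ : Fin C.m} (hk : k₀ ∉ C.xorPart) (a : Fin 2) :
    C.arg k₀ a ≠ .gate k₀ := fun h =>
  lt_irrefl _ (C.rank_lt hk h hk)

variable {C} in
/-- **In a fair semicircuit, a gate fed by a constant does not read itself** (in the xor-part its
equation `G = G ⊕ b ⊕ c` would be vacuous or contradictory, i.e. the coordinate `G` of the
xor-part self-map constant; in the acyclic part by acyclicity). This discharges the hypothesis
`hself` of Rules 2 and 3. [cite: LiYang2022, §2.5] -/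
theorem Fair.not_reads_self_of_const (hF : C.Fair) {k₀ : Fin C.m} {a₀ : Fin 2} {b : Bool}
    (h₀ : C.arg k₀ a₀ = .const b) : ∀ a, C.arg k₀ a ≠ .gate k₀ := by
  intro a ha
  by_cases hk : k₀ ∈ C.xorPart
  · obtain ⟨c, hc⟩ := C.isXorOp_of_mem k₀ hk
    -- the coordinate `k₀` of the self-map is the constant `b ⊕ c`
    have hconst : ∀ (x : Fin n → Bool) (u : C.KVec), C.xorMap x u ⟨k₀, hk⟩ = (b ^^ c) := by
      intro x u
      have ha₀ : a ≠ a₀ := fun h => by rw [h, h₀] at ha; cases ha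
      unfold xorMap
      rw [hc]
      -- the two wires are `gate k₀` (at `a`) and `const b` (at `a₀`)
      obtain rfl | rfl : a₀ = 0 ∨ a₀ = 1 := by fin_cases a₀ <;> simp
      · obtain rfl : a = 1 := by fin_cases a <;> simp_all
        rw [h₀, ha]
        show (u ⟨k₀, hk⟩ ^^ ((b ^^ C.extendK u k₀) ^^ c)) = _
        rw [C.extendK_apply_mem u hk]
        cases u ⟨k₀, hk⟩ <;> cases b <;> cases c <;> rfl
      · obtain rfl : a = 0 := by fin_cases a <;> simp_all
        rw [h₀, ha]
        show (u ⟨k₀, hk⟩ ^^ ((C.extendK u k₀ ^^ b) ^^ c)) = _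
        rw [C.extendK_apply_mem u hk]
        cases u ⟨k₀, hk⟩ <;> cases b <;> cases c <;> rfl
    obtain ⟨u, hu⟩ := hF.xorMap_surjective (fun _ => false) (fun k => decide (k = ⟨k₀, hk⟩) ^^ (b ^^ c))
    have := congrFun hu ⟨k₀, hk⟩
    rw [hconst] at this
    revert this
    cases b <;> cases c <;> simp
  · exact C.arg_ne_self_of_not_mem hk a ha

variable {C} in
/-- **In a fair semicircuit, a gate fed by a variable does not read itself** (its equation
`G = G ⊕ x_i ⊕ c` would force `x_i = c`). [cite: LiYang2022, §2.5] -/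
theorem Fair.not_reads_self_of_var (hF : C.Fair) {k₀ : Fin C.m} {a₀ : Fin 2} {i : Fin n}
    (h₀ : C.arg k₀ a₀ = .var i) : ∀ a, C.arg k₀ a ≠ .gate k₀ := by
  intro a ha
  by_cases hk : k₀ ∈ C.xorPart
  · obtain ⟨c, hc⟩ := C.isXorOp_of_mem k₀ hk
    have ha₀ : a ≠ a₀ := fun h => by rw [h, h₀] at ha; cases ha
    -- input with `x_i ≠ c`
    set x : Fin n → Bool := fun _ => !c with hx
    obtain ⟨w, hw, -⟩ := hF x
    have := hw k₀
    rw [hc] at this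
    obtain rfl | rfl : a₀ = 0 ∨ a₀ = 1 := by fin_cases a₀ <;> simp
    · obtain rfl : a = 1 := by fin_cases a <;> simp_all
      rw [h₀, ha] at this
      change w k₀ = ((x i ^^ w k₀) ^^ c) at this
      revert this
      rw [hx]
      cases w k₀ <;> cases c <;> simp
    · obtain rfl : a = 0 := by fin_cases a <;> simp_all
      rw [h₀, ha] at this
      change w k₀ = ((w k₀ ^^ x i) ^^ c) at this
      revert this
      rw [hx]
      cases w k₀ <;> cases c <;> simp
  · exact C.arg_ne_self_of_not_mem hk a ha

end Semicircuit

end Literature.Computability.Complexity
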